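import Mathlib
import Literature.Analysis.FluidPDE.EnergyToolkit
import HarnessLib

/-!
# Crux `PoloidalLiouville` (stmt-NavierStokesRegularity-1222, wall W1), crux idea «steady-centre-sieve» (ns-idea-15):
# TIME-DEPENDENT SPATIAL JETS — `∂ₜ` commutes with the spatial Taylor terms of a jointly smooth field

Support file (`--supports stmt-NavierStokesRegularity-1222`, helper; cell `ns-wall-extremal`, width hand ns-wall-eng-7 g7, 0 kit).
The one new kernel ingredient of the «EVOLUTION L1» item of the CentreJet line (ns-wall-crit-1 g5 05:58:44Z: size M, no strike):
for a field `w : ℝ → X → F` jointly `C^∞` on `S × X` (`IsSmoothSpaceTimeOn S w`, tree), `S` a time set of unique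
differentiability contained in the closure of its interior (every interval),

* `isSmoothSpaceTimeOn_iteratedFDeriv_slice` — the SPATIAL JETS `(s, x) ↦ Dⁿ(w s)(x)` are again jointly smooth
  (induction on `n` through `iteratedFDeriv_succ_eq_comp_left` and the tree's `IsSmoothSpaceTimeOn.fderiv_slice`);
* `timeDerivWithin_iteratedFDeriv_slice` — **`∂ₜ Dⁿ = Dⁿ ∂ₜ`**: `timeDerivWithin S (fun s x => Dⁿ(w s)(x)) t x = Dⁿ(∂ₜw(t))(x)`,
  `∂ₜ = timeDerivWithin S` (induction on the tree's ONE-STEP exchange `IsSmoothSpaceTimeOn.timeDerivWithin_fderiv_slice_apply`,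
  EnergyToolkit — Schwarz in space–time for the jointly `C^∞` uncurried field; NO joint analyticity is needed, unlike a route
  through Mathlib's `ContDiffAt.iteratedFDeriv_comp_perm`, which this pin has only at `ω`);
* `hasDerivWithinAt_diag_slice` — hence the diagonal Taylor terms `s ↦ Dⁿ(w s)(x₀)(y,…,y)` are differentiable within `S`
  with derivative the corresponding term of `∂ₜw(t)`;
* `diag_timeDerivWithin_eq_zero` — and a diagonal term that vanishes at EVERY time of `S` vanishes for `∂ₜw(t)`, `t ∈ S`.

HONEST FRAME: calculus; closes no crux or sketch Prop; `PoloidalLiouville` (1222) and NS regularity OPEN.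
-/

-- the summit and its single sub-problem share the name (CONVENTIONS §1)
set_option linter.dupNamespace false

noncomputable section

namespace Summit.NavierStokesRegularity.NavierStokesRegularity.Theorems.PoloidalLiouville.JetCalculus

open Set Function Filter Topology
open scoped ContDiff
open Literature.Analysis.FluidPDE

variable {X F : Type*} [NormedAddCommGroup X] [NormedSpace ℝ X] [NormedAddCommGroup F] [NormedSpace ℝ F]
variable {S : Set ℝ} {w : ℝ → X → F}

/-- **The spatial jets of a jointly smooth field are jointly smooth**: `(s, x) ↦ Dⁿ(w s)(x)` is `IsSmoothSpaceTimeOn S`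
(`S` of unique differentiability). -/
theorem isSmoothSpaceTimeOn_iteratedFDeriv_slice (h : IsSmoothSpaceTimeOn S w) (hS : UniqueDiffOn ℝ S) :
    ∀ n : ℕ, IsSmoothSpaceTimeOn S (fun s x => iteratedFDeriv ℝ n (w s) x)
  | 0 => by
    have e : (fun s x => iteratedFDeriv ℝ 0 (w s) x) =
        fun s x => (continuousMultilinearCurryFin0 ℝ X F).symm (w s x) := by
      funext s x
      ext m
      simp
    rw [e]
    exact h.clm_comp ((continuousMultilinearCurryFin0 ℝ X F).symm : F →L[ℝ] (X [×0]→L[ℝ] F))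
  | n + 1 => by
    have ih := isSmoothSpaceTimeOn_iteratedFDeriv_slice h hS n
    have e : (fun s x => iteratedFDeriv ℝ (n + 1) (w s) x) = fun s x =>
        ((continuousMultilinearCurryLeftEquiv ℝ (fun _ : Fin (n + 1) => X) F).symm :
          (X →L[ℝ] (X [×n]→L[ℝ] F)) →L[ℝ] (X [×(n + 1)]→L[ℝ] F))
          (fderiv ℝ (fun x => iteratedFDeriv ℝ n (w s) x) x) := by
      funext s x
      rw [iteratedFDeriv_succ_eq_comp_left]
      rfl
    rw [e]
    exact (ih.fderiv_slice hS).clm_comp _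

/-- Operator form of the tree's one-step exchange: `∂ₜ (D(w ·)(x)) (t) = D(∂ₜ w(t))(x)` as continuous linear maps. -/
theorem timeDerivWithin_fderiv_slice (h : IsSmoothSpaceTimeOn S w) (hS : UniqueDiffOn ℝ S)
    (hcl : S ⊆ closure (interior S)) {t : ℝ} (ht : t ∈ S) (x : X) :
    timeDerivWithin S (fun s y => fderiv ℝ (w s) y) t x = fderiv ℝ (timeDerivWithin S w t) x := by
  ext v
  have h1 := (h.fderiv_slice hS).timeDerivWithin_clm_comp hS (ContinuousLinearMap.apply ℝ F v) ht x
  simp only [ContinuousLinearMap.apply_apply] at h1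
  rw [← h1]
  exact h.timeDerivWithin_fderiv_slice_apply hS hcl ht x v

/-- **`∂ₜ Dⁿ = Dⁿ ∂ₜ` for jointly smooth fields**: on a time set `S` of unique differentiability with
`S ⊆ closure (interior S)`, for `t ∈ S`,
`timeDerivWithin S (fun s x => Dⁿ(w s)(x)) t x = Dⁿ(timeDerivWithin S w t)(x)`. -/
theorem timeDerivWithin_iteratedFDeriv_slice (h : IsSmoothSpaceTimeOn S w) (hS : UniqueDiffOn ℝ S)
    (hcl : S ⊆ closure (interior S)) :
    ∀ (n : ℕ) {t : ℝ} (_ : t ∈ S) (x : X),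
      timeDerivWithin S (fun s y => iteratedFDeriv ℝ n (w s) y) t x = iteratedFDeriv ℝ n (timeDerivWithin S w t) x
  | 0, t, ht, x => by
    set L : F →L[ℝ] (X [×0]→L[ℝ] F) :=
      ((continuousMultilinearCurryFin0 ℝ X F).symm : F →L[ℝ] (X [×0]→L[ℝ] F)) with hL
    have e : (fun s y => iteratedFDeriv ℝ 0 (w s) y) = fun s y => L (w s y) := by
      funext s y
      ext m
      simp [hL]
    rw [e, h.timeDerivWithin_clm_comp hS L ht x]
    ext m
    simp [hL]
  | n + 1, t, ht, x => by
    have ih := isSmoothSpaceTimeOn_iteratedFDeriv_slice h hS n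
    set L : (X →L[ℝ] (X [×n]→L[ℝ] F)) →L[ℝ] (X [×(n + 1)]→L[ℝ] F) :=
      ((continuousMultilinearCurryLeftEquiv ℝ (fun _ : Fin (n + 1) => X) F).symm :
        (X →L[ℝ] (X [×n]→L[ℝ] F)) →L[ℝ] (X [×(n + 1)]→L[ℝ] F)) with hL
    have e : (fun s y => iteratedFDeriv ℝ (n + 1) (w s) y) =
        fun s y => L (fderiv ℝ (fun z => iteratedFDeriv ℝ n (w s) z) y) := by
      funext s y
      rw [iteratedFDeriv_succ_eq_comp_left]
      rfl
    rw [e, (ih.fderiv_slice hS).timeDerivWithin_clm_comp hS L ht x, timeDerivWithin_fderiv_slice ih hS hcl ht x]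
    -- identify `∂ₜ` of the `n`-jets with the `n`-jet of `∂ₜ w` (induction hypothesis, as functions of `y`)
    have hfun : timeDerivWithin S (fun s y => iteratedFDeriv ℝ n (w s) y) t =
        fun y => iteratedFDeriv ℝ n (timeDerivWithin S w t) y := by
      funext y
      exact timeDerivWithin_iteratedFDeriv_slice h hS hcl n ht y
    rw [hfun, iteratedFDeriv_succ_eq_comp_left]
    rfl

/-- **Time derivative of a spatial Taylor term**: for `t ∈ S`,
`s ↦ Dⁿ(w s)(x₀)(y,…,y)` has derivative `Dⁿ(∂ₜw(t))(x₀)(y,…,y)` within `S` at `t`. -/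
theorem hasDerivWithinAt_diag_slice (h : IsSmoothSpaceTimeOn S w) (hS : UniqueDiffOn ℝ S)
    (hcl : S ⊆ closure (interior S)) (n : ℕ) {t : ℝ} (ht : t ∈ S) (x₀ y : X) :
    HasDerivWithinAt (fun s => iteratedFDeriv ℝ n (w s) x₀ (fun _ => y))
      (iteratedFDeriv ℝ n (timeDerivWithin S w t) x₀ (fun _ => y)) S t := by
  have hJ := isSmoothSpaceTimeOn_iteratedFDeriv_slice h hS n
  have hD := hJ.hasDerivWithinAt_timeDerivWithin hS ht x₀
  have hev := ((ContinuousMultilinearMap.apply ℝ (fun _ : Fin n => X) F (fun _ => y)).hasFDerivAt).comp_hasDerivWithinAt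
    t hD
  rw [timeDerivWithin_iteratedFDeriv_slice h hS hcl n ht x₀] at hev
  simpa only [ContinuousMultilinearMap.apply_apply, comp_def] using hev

/-- **A spatial Taylor term that vanishes at every time vanishes for `∂ₜw`**: if `Dⁿ(w s)(x₀)(y,…,y) = 0` for all
`s ∈ S` then `Dⁿ(∂ₜw(t))(x₀)(y,…,y) = 0` for `t ∈ S`. -/
theorem diag_timeDerivWithin_eq_zero (h : IsSmoothSpaceTimeOn S w) (hS : UniqueDiffOn ℝ S)
    (hcl : S ⊆ closure (interior S)) (n : ℕ) {t : ℝ} (ht : t ∈ S) (x₀ y : X)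
    (h0 : ∀ s ∈ S, iteratedFDeriv ℝ n (w s) x₀ (fun _ => y) = 0) :
    iteratedFDeriv ℝ n (timeDerivWithin S w t) x₀ (fun _ => y) = 0 := by
  have h1 := hasDerivWithinAt_diag_slice h hS hcl n ht x₀ y
  have h2 : HasDerivWithinAt (fun s => iteratedFDeriv ℝ n (w s) x₀ (fun _ => y)) 0 S t :=
    (hasDerivWithinAt_const t S (0 : F)).congr (fun s hs => h0 s hs) (h0 t ht)
  exact (hS t ht).eq_deriv _ h1 h2

end Summit.NavierStokesRegularity.NavierStokesRegularity.Theorems.PoloidalLiouville.JetCalculus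

end
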